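import Literature.AlgebraicGeometry.Resolution.ResolutionOfComponents
import Literature.AlgebraicGeometry.Morphisms.RefinedValuativeCriterionDense
import Mathlib.AlgebraicGeometry.Morphisms.ClosedImmersion
import Mathlib.AlgebraicGeometry.Morphisms.Separated
import Mathlib.AlgebraicGeometry.Morphisms.FiniteType
import Mathlib.AlgebraicGeometry.Morphisms.QuasiCompact
import Mathlib.CategoryTheory.Limits.Shapes.Pullback.Pasting
import Mathlib.FieldTheory.PurelyInseparable.Basic
import Mathlib.FieldTheory.IntermediateField.Adjoin.Basic
import Mathlib.Algebra.CharP.Reduced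
import Mathlib.Algebra.CharP.Algebra
import HarnessLib

/-!
# `WeightedInvariant.DescentPerfectToAll`, line `root-of-a-constant`: the tower induction

Route `ResolutionOfSingularities/WeightedInvariant`, crux `DescentPerfectToAll`
(stmt-ResolutionOfSingularities-0549), stub `stub_towerInduction` of the lead's skeleton
`work/DescentPerfectToAll.lean`, PROVED here (statement verbatim from the ledger registration).

**Statement.** Fix a prime `p`. Say that *resolutions descend along `K/k`* if for every reduced
separated `k`-scheme of finite type `f : X → Spec k` and every surjective closed immersion
`ι : Z ↪ X ×_k K` from a reduced scheme `Z` (i.e. `Z = (X ×_k K)_red`), a resolution of `Z` yields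
a resolution of `X`. Assume the ONE-ROOT STEP: resolutions descend along every simple extension
`K = k(α)` with `α ^ p = a ∈ k`, `a ∉ k ^ p`, `char k = p`. Then resolutions descend along every
finite purely inseparable extension `K/k` of fields of characteristic `p`.

**Proof.** Strong induction on `[K : k]`, with the fields varying.

* *Transitivity* (`descent_trans`): if resolutions descend along `k₁/k` and along `K/k₁`, they
  descend along `K/k`. Given `X/k` and `ι : Z ↪ X_K`, put `X₁ = X ×_k k₁`, `Y = (X₁)_red` (Mathlib
  `Scheme.nilradical`, in-tree `isReduced_subscheme_nilradical`, `surjective_subschemeι_nilradical`)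
  with structure map `Y ↪ X₁ → Spec k₁` (separated, of finite type). Pullback pasting identifies
  `X_K ≅ X₁ ×_{k₁} K` and `Y ×_{k₁} K ≅ Y ×_{X₁} (X₁ ×_{k₁} K)`; the reduced `Z` maps to `Y` through
  `Z → X₁ ×_{k₁} K → X₁` (a morphism from a reduced scheme kills the nilradical, in-tree
  `nilradical_le_ker`), whence `ι' : Z → Y ×_{k₁} K`, a closed immersion (its composite with the
  closed immersion `Y ×_{k₁} K ↪ X₁ ×_{k₁} K` is) and surjective (that closed immersion is
  injective). Descent along `K/k₁` resolves `Y`, then descent along `k₁/k` (with `Y ↪ X₁`)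
  resolves `X`.
* *Base* (`descent_of_bijective`): if `k = K` then `X_K → X` is an isomorphism and the surjective
  closed immersion `Z ↪ X_K ≅ X` into a reduced scheme is an isomorphism (Mathlib
  `isIso_of_isClosedImmersion_of_surjective`); transport the resolution (`HasResolution.of_iso`).
* *Step* (`exists_root_not_mem_range`): if `k ≠ K`, pick `β ∈ K ∖ k`; pure inseparability gives
  `β ^ (p ^ n) ∈ k` for some `n`, and the least such `n ≥ 1` yields `α = β ^ (p ^ (n - 1)) ∉ k` with
  `α ^ p = a ∈ k`; then `a ∉ k ^ p` (Frobenius is injective on the field `K`). With `k₁ = k(α)`,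
  `[k₁ : k] ≥ 2` so `[K : k₁] < [K : k]`; the one-root step gives descent along `k₁/k`, the
  induction hypothesis gives descent along `K/k₁`, and transitivity concludes.
-/

-- single-problem summit: the doubled namespace component `ResolutionOfSingularities` is forced
set_option linter.dupNamespace false -- mandated namespace of this single-conjunct summit

noncomputable section

open CategoryTheory CategoryTheory.Limits AlgebraicGeometry
open Literature.AlgebraicGeometry.Resolution Literature.AlgebraicGeometry.Morphisms

namespace Summit.ResolutionOfSingularities.ResolutionOfSingularities.Theorems

universe u

/-! ## Field theory: one root of a constant inside a purely inseparable extension -/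

/-- In a nontrivial purely inseparable extension `K/k` of characteristic `p` there is an element
`α ∉ k` with `α ^ p = a ∈ k`, and then `a` is not a `p`-th power in `k` (take `β ∉ k`, the least
`n` with `β ^ (p ^ n) ∈ k`, and `α = β ^ (p ^ (n-1))`; Frobenius is injective on `K`). [folklore] -/
theorem exists_root_not_mem_range {k K : Type*} [Field k] [Field K] [Algebra k K] (p : ℕ)
    [Fact p.Prime] [CharP k p] [IsPurelyInseparable k K]
    (hK : ¬ Function.Surjective (algebraMap k K)) :
    ∃ (a : k) (α : K), (∀ b : k, b ^ p ≠ a) ∧ α ^ p = algebraMap k K a ∧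
      α ∉ Set.range (algebraMap k K) := by
  obtain ⟨β, hβ⟩ : ∃ β : K, β ∉ Set.range (algebraMap k K) := by
    by_contra! h
    exact hK fun x => h x
  obtain ⟨n, hn⟩ := IsPurelyInseparable.pow_mem k p β
  -- descend along the least `p`-power exponent landing in `k`
  have key : ∀ (m : ℕ) (γ : K), γ ^ p ^ m ∈ (algebraMap k K).range →
      γ ∉ Set.range (algebraMap k K) →
      ∃ α : K, α ^ p ∈ Set.range (algebraMap k K) ∧ α ∉ Set.range (algebraMap k K) := by
    intro m
    induction m with
    | zero =>
      intro γ h1 h2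
      rw [pow_zero, pow_one] at h1
      exact absurd (RingHom.mem_range.mp h1) h2
    | succ m ih =>
      intro γ h1 h2
      by_cases h3 : γ ^ p ∈ Set.range (algebraMap k K)
      · exact ⟨γ, h3, h2⟩
      · exact ih (γ ^ p) (by rwa [← pow_mul, ← pow_succ']) h3
  obtain ⟨α, ⟨a, ha⟩, hα⟩ := key n β hn hβ
  haveI : CharP K p := charP_of_injective_algebraMap (algebraMap k K).injective p
  refine ⟨a, α, fun b hb => hα ⟨b, ?_⟩, ha.symm, hα⟩
  -- `b ^ p = a` forces `α = b`: Frobenius is injective on the reduced ring `K`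
  apply frobenius_inj K p
  rw [frobenius_def, frobenius_def, ← map_pow, hb, ha]

/-! ## Scheme theory: descent of resolutions is transitive in towers -/

/-- **Base of the induction.** If `k → K` is bijective, resolutions descend along `K/k`: the
projection `X ×_k K → X` is an isomorphism, so a surjective closed immersion `ι : Z ↪ X ×_k K` into
the reduced scheme `X ×_k K ≅ X` is an isomorphism, along which a resolution of `Z` is transported.
[folklore] -/
theorem descent_of_bijective {k K : Type u} [Field k] [Field K] [Algebra k K]
    (hK : Function.Bijective (algebraMap k K)) {X : Scheme.{u}} (f : X ⟶ Spec (.of k))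
    [IsReduced X] {Z : Scheme.{u}}
    (ι : Z ⟶ pullback f (Spec.map (CommRingCat.ofHom (algebraMap k K))))
    [IsClosedImmersion ι] [Surjective ι] (hZ : Scheme.HasResolution Z) :
    Scheme.HasResolution X := by
  haveI : IsIso (CommRingCat.ofHom (algebraMap k K)) :=
    (RingEquiv.ofBijective (algebraMap k K) hK).toCommRingCatIso.isIso_hom
  haveI : IsIso (ι ≫ pullback.fst f (Spec.map (CommRingCat.ofHom (algebraMap k K)))) :=
    isIso_of_isClosedImmersion_of_surjective _
  exact hZ.of_iso (ι ≫ pullback.fst f (Spec.map (CommRingCat.ofHom (algebraMap k K))))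

/-- **Transitivity of descent in a tower `k → k₁ → K`.** If resolutions descend along `k₁/k` and
along `K/k₁` then they descend along `K/k`: for `ι : Z ↪ X_K` one passes through the reduction
`Y = (X ×_k k₁)_red`, a reduced separated `k₁`-scheme of finite type with
`Y ×_{k₁} K ↪ X ×_k K` a closed immersion with the same support, through which `Z` (reduced)
factors by a surjective closed immersion. [folklore] -/
theorem descent_trans {k k₁ K : Type u} [Field k] [Field k₁] [Field K] [Algebra k k₁]
    [Algebra k₁ K] [Algebra k K] [IsScalarTower k k₁ K]
    (h₁ : ∀ (X : Scheme.{u}) (f : X ⟶ Spec (.of k)), IsSeparated f → LocallyOfFiniteType f →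
      QuasiCompact f → IsReduced X → ∀ (Z : Scheme.{u})
      (ι : Z ⟶ pullback f (Spec.map (CommRingCat.ofHom (algebraMap k k₁)))),
      IsClosedImmersion ι → Surjective ι → IsReduced Z → Scheme.HasResolution Z →
      Scheme.HasResolution X)
    (h₂ : ∀ (X : Scheme.{u}) (f : X ⟶ Spec (.of k₁)), IsSeparated f → LocallyOfFiniteType f →
      QuasiCompact f → IsReduced X → ∀ (Z : Scheme.{u})
      (ι : Z ⟶ pullback f (Spec.map (CommRingCat.ofHom (algebraMap k₁ K)))),
      IsClosedImmersion ι → Surjective ι → IsReduced Z → Scheme.HasResolution Z →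
      Scheme.HasResolution X) :
    ∀ (X : Scheme.{u}) (f : X ⟶ Spec (.of k)), IsSeparated f → LocallyOfFiniteType f →
      QuasiCompact f → IsReduced X → ∀ (Z : Scheme.{u})
      (ι : Z ⟶ pullback f (Spec.map (CommRingCat.ofHom (algebraMap k K)))),
      IsClosedImmersion ι → Surjective ι → IsReduced Z → Scheme.HasResolution Z →
      Scheme.HasResolution X := by
  intro X f hsep hlft hqc hred Z ι hι hsurj hZred hZ
  -- the two base extensions `Spec k₁ → Spec k`, `Spec K → Spec k₁` and their composite
  have hcomp : Spec.map (CommRingCat.ofHom (algebraMap k₁ K)) ≫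
      Spec.map (CommRingCat.ofHom (algebraMap k k₁)) =
      Spec.map (CommRingCat.ofHom (algebraMap k K)) := by
    rw [← Spec.map_comp, ← CommRingCat.ofHom_comp, ← IsScalarTower.algebraMap_eq]
  -- `X₁ = X ×_k k₁ → Spec k₁`, its reduction `j₀ : Y ↪ X₁`
  let q : pullback f (Spec.map (CommRingCat.ofHom (algebraMap k k₁))) ⟶ Spec (.of k₁) :=
    pullback.snd f (Spec.map (CommRingCat.ofHom (algebraMap k k₁)))
  let j₀ := (pullback f (Spec.map (CommRingCat.ofHom (algebraMap k k₁)))).nilradical.subschemeι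
  -- `X₁ ×_{k₁} K ≅ X ×_k K` (pullback pasting), and `ι₂ : Z ↪ X₁ ×_{k₁} K`
  let e : pullback q (Spec.map (CommRingCat.ofHom (algebraMap k₁ K))) ≅
      pullback f (Spec.map (CommRingCat.ofHom (algebraMap k K))) :=
    pullbackLeftPullbackSndIso f (Spec.map (CommRingCat.ofHom (algebraMap k k₁)))
      (Spec.map (CommRingCat.ofHom (algebraMap k₁ K))) ≪≫ pullback.congrHom rfl hcomp
  let ι₂ : Z ⟶ pullback q (Spec.map (CommRingCat.ofHom (algebraMap k₁ K))) := ι ≫ e.inv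
  haveI : IsClosedImmersion ι₂ := inferInstance
  haveI : Surjective ι₂ := inferInstance
  -- `π : X₁ ×_{k₁} K → X₁`; the reduced `Z` maps to `Y = (X₁)_red`
  let π : pullback q (Spec.map (CommRingCat.ofHom (algebraMap k₁ K))) ⟶
      pullback f (Spec.map (CommRingCat.ofHom (algebraMap k k₁))) :=
    pullback.fst q (Spec.map (CommRingCat.ofHom (algebraMap k₁ K)))
  let a : Z ⟶ (pullback f (Spec.map (CommRingCat.ofHom (algebraMap k k₁)))).nilradical.subscheme :=
    IsClosedImmersion.lift j₀ (ι₂ ≫ π)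
      (by rw [Scheme.IdealSheafData.ker_subschemeι]; exact nilradical_le_ker _)
  have ha : a ≫ j₀ = ι₂ ≫ π := IsClosedImmersion.lift_fac _ _ _
  -- `b : Z → Y ×_{X₁} (X₁ ×_{k₁} K)`, a surjective closed immersion
  let b : Z ⟶ pullback j₀ π := pullback.lift a ι₂ ha
  have hb : b ≫ pullback.snd j₀ π = ι₂ := pullback.lift_snd _ _ _
  haveI : IsClosedImmersion b := by
    have : IsClosedImmersion (b ≫ pullback.snd j₀ π) := by rw [hb]; infer_instance
    exact IsClosedImmersion.of_comp_isClosedImmersion b (pullback.snd j₀ π)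
  haveI : Surjective b := ⟨fun x => by
    obtain ⟨z, hz⟩ := ι₂.surjective (pullback.snd j₀ π x)
    refine ⟨z, (pullback.snd j₀ π).isClosedEmbedding.injective ?_⟩
    rw [← Scheme.Hom.comp_apply, hb, hz]⟩
  -- `ι' : Z → Y ×_{k₁} K` (pasting `Y ×_{X₁} (X₁ ×_{k₁} K) ≅ Y ×_{k₁} K`)
  let ι' : Z ⟶ pullback (j₀ ≫ q) (Spec.map (CommRingCat.ofHom (algebraMap k₁ K))) :=
    b ≫ (pullbackRightPullbackFstIso q (Spec.map (CommRingCat.ofHom (algebraMap k₁ K))) j₀).hom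
  haveI : IsClosedImmersion ι' := inferInstance
  haveI : Surjective ι' := inferInstance
  haveI := hsep; haveI := hlft; haveI := hqc; haveI := hZred
  -- descent along `K/k₁` resolves `Y`, then descent along `k₁/k` resolves `X`
  have hY : Scheme.HasResolution
      (pullback f (Spec.map (CommRingCat.ofHom (algebraMap k k₁)))).nilradical.subscheme :=
    h₂ _ (j₀ ≫ q) inferInstance inferInstance inferInstance inferInstance Z ι' inferInstance
      inferInstance hZred hZ
  exact h₁ X f hsep hlft hqc hred _ j₀ inferInstance inferInstance inferInstance hY

/-! ## The tower induction -/

/-- STUB `stub_towerInduction`: assuming the ONE-ROOT STEP (resolutions descend along every simple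
extension `k(α)/k` with `α ^ p = a ∈ k ∖ k ^ p`), resolutions descend along every finite purely
inseparable extension `K/k` in characteristic `p` — strong induction on `[K : k]`: either `k = K`
(`descent_of_bijective`), or `K ⊋ k₁ = k(α) ⊋ k` with `α ^ p ∈ k` (`exists_root_not_mem_range`),
`[K : k₁] < [K : k]`, and descent along `k₁/k` (one-root step) and along `K/k₁` (induction)
compose (`descent_trans`). [folklore] -/
theorem stub_towerInduction : ∀ (p : ℕ) [Fact p.Prime], (∀ (k K : Type) [Field k] [Field K] [Algebra k K] [CharP k p] (a : k) (α : K), (∀ b : k, b ^ p ≠ a) → α ^ p = algebraMap k K a → IntermediateField.adjoin k {α} = ⊤ → ∀ (X : Scheme.{0}) (f : X ⟶ Spec (.of k)), IsSeparated f → LocallyOfFiniteType f → QuasiCompact f → IsReduced X → ∀ (Z : Scheme.{0}) (ι : Z ⟶ pullback f (Spec.map (CommRingCat.ofHom (algebraMap k K)))), IsClosedImmersion ι → Surjective ι → IsReduced Z → Scheme.HasResolution Z → Scheme.HasResolution X) → ∀ (k K : Type) [Field k] [Field K] [Algebra k K] [CharP k p] [FiniteDimensional k K] [IsPurelyInseparable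 k K] (X : Scheme.{0}) (f : X ⟶ Spec (.of k)), IsSeparated f → LocallyOfFiniteType f → QuasiCompact f → IsReduced X → ∀ (Z : Scheme.{0}) (ι : Z ⟶ pullback f (Spec.map (CommRingCat.ofHom (algebraMap k K)))), IsClosedImmersion ι → Surjective ι → IsReduced Z → Scheme.HasResolution Z → Scheme.HasResolution X := by
  intro p _ H
  -- strong induction on the degree `[K : k]`, all fields varying
  suffices key : ∀ (n : ℕ) (k K : Type) [Field k] [Field K] [Algebra k K] [CharP k p]
      [FiniteDimensional k K] [IsPurelyInseparable k K], Module.finrank k K = n →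
      ∀ (X : Scheme.{0}) (f : X ⟶ Spec (.of k)), IsSeparated f → LocallyOfFiniteType f →
      QuasiCompact f → IsReduced X → ∀ (Z : Scheme.{0})
      (ι : Z ⟶ pullback f (Spec.map (CommRingCat.ofHom (algebraMap k K)))),
      IsClosedImmersion ι → Surjective ι → IsReduced Z → Scheme.HasResolution Z →
      Scheme.HasResolution X by
    intro k K _ _ _ _ _ _
    exact key _ k K rfl
  intro n
  induction n using Nat.strong_induction_on with
  | _ n ih =>
  intro k K _ _ _ _ _ _ hn
  by_cases hs : Function.Surjective (algebraMap k K)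
  · -- base: `k = K`
    intro X f _ _ _ hred Z ι hι hsurj _ hZ
    haveI := hred; haveI := hι; haveI := hsurj
    exact descent_of_bijective ⟨(algebraMap k K).injective, hs⟩ f ι hZ
  · -- step: `k ⊊ k₁ = k(α) ⊆ K` with `α ^ p = a ∈ k ∖ k ^ p`
    obtain ⟨a, α, ha, hα, hαk⟩ := exists_root_not_mem_range p hs
    haveI : CharP (IntermediateField.adjoin k {α}) p :=
      charP_of_injective_algebraMap (algebraMap k (IntermediateField.adjoin k {α})).injective p
    -- `k₁ = k(α)` is generated over `k` by `α`
    have htop : IntermediateField.adjoin k {IntermediateField.AdjoinSimple.gen k α} = ⊤ := by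
      apply IntermediateField.lift_injective
      rw [IntermediateField.lift_adjoin_simple, IntermediateField.lift_top,
        IntermediateField.AdjoinSimple.coe_gen]
    have hpow : IntermediateField.AdjoinSimple.gen k α ^ p =
        algebraMap k (IntermediateField.adjoin k {α}) a := by
      apply Subtype.ext
      rw [IntermediateField.coe_pow, IntermediateField.AdjoinSimple.coe_gen, hα]
      rfl
    -- `[K : k(α)] < [K : k]` since `[k(α) : k] ≥ 2`
    have hlt : Module.finrank (IntermediateField.adjoin k {α}) K < n := by
      have h1 := Module.finrank_mul_finrank k (IntermediateField.adjoin k {α}) K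
      have h2 : Module.finrank k (IntermediateField.adjoin k {α}) ≠ 1 := fun h =>
        hαk (IntermediateField.mem_bot.mp
          (IntermediateField.finrank_adjoin_simple_eq_one_iff.mp h))
      have h3 : 0 < Module.finrank k (IntermediateField.adjoin k {α}) := Module.finrank_pos
      have h4 : 0 < Module.finrank (IntermediateField.adjoin k {α}) K := Module.finrank_pos
      rw [← hn, ← h1]
      exact lt_mul_left h4 (by omega)
    -- descent along `k(α)/k` (one-root step) and along `K/k(α)` (induction) compose
    exact descent_trans (H k (IntermediateField.adjoin k {α}) a
      (IntermediateField.AdjoinSimple.gen k α) ha hpow htop)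
      (ih _ hlt (IntermediateField.adjoin k {α}) K rfl)

end Summit.ResolutionOfSingularities.ResolutionOfSingularities.Theorems

end
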